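import Literature.NumberTheory.Automorphic.ReciprocityGLnRankOneProofs
import Literature.NumberTheory.GaloisRepresentations.WeakAbelianDirectSummandCyclotomicProofs
import Literature.NumberTheory.Automorphic.GLOneArchParameterOfAlgebraicCharacter
import Literature.NumberTheory.Automorphic.GLOneOfHeckeCharacterBJ
import Literature.FieldTheory.AlgClosed.PadicAlgClEquivComplex
import HarnessLib

/-!
# `GaloisRepOfRegularAlgebraic` (stmt-Langlands-10785): the guard `ℓ ∉ v` is load-bearing

Negative lemma for the crux `GaloisRepOfRegularAlgebraic` of route `IrreducibilityBySelfDuality`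
(= lang.S27 verbatim: Harris–Lan–Taylor–Thorne Thm. A + Varma Cor. 9.3).  The crux asks, for a
regular algebraic cuspidal `π` on `GL_n(𝔸_K)` (`K` totally real or CM), every `ℓ` and every
`ι : ℚ̄_ℓ ≃+* ℂ`, for a continuous semisimple `r : Γ_K → GL_n(ℚ̄_ℓ)` which is unramified with the
predicted arithmetic-Frobenius polynomial `arithFrobPolyOfSatake ι q_v n α` at every finite place
`v` where `π` has Satake parameter `α` **and `v ∤ ℓ`**.

`galoisRepOfRegularAlgebraic_false_without_primeToEll` proves FALSE, sorry-free, the same text with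
the guard `((ℓ : ℕ) : 𝓞 K) ∉ v.asIdeal →` deleted (compatibility demanded also at the unramified
places over `ℓ`; named `GaloisRepOfRegularAlgebraicWithoutPrimeToEll` in the crux work-file), by the
rank-one witness `n = 1`, `K = ℚ`, `π = π_{‖·‖}` (the Borel–Jacquet datum `ℂ·‖det‖ / ⊥` of the norm
character, regular algebraic of infinity type `a = 1`):

* (`norm_apply_eq_one_of_rank_one`) for ANY continuous `r : Γ_K → GL₁(ℚ̄_ℓ)` and any `σ`, the entry
  `(r σ)₀₀` is an `ℓ`-adic unit — `σ ↦ ‖(r σ)₀₀‖` is a continuous homomorphism of the compact group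
  `Γ_K` into `ℝ_{>0}`, hence bounded, hence trivial;
* (`satakeParam_eq_of_normDatum`) every Satake parameter of `π_{‖·‖}` at `v` is `{(N v)⁻¹}`, so the
  predicted arithmetic-Frobenius polynomial is `X - N v` (`arithFrobPolyOfSatake_one`): the `r` the
  crux wants is the cyclotomic character, `χ_ℓ(Frob_v) = N v`;
* at a place `v ∣ ℓ` this asks `(r Frob_v)₀₀ = N v = ℓ^f`, of `ℓ`-adic absolute value `< 1` —
  contradiction (`not_hasFrobCharpolyAt_normDatum_above`, for EVERY number field `K`, every `ℓ`,
  every `ι` and every `v ∣ ℓ` carrying a Satake parameter); and `π_{‖·‖}` does carry a Satake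
  parameter at some place `v`, above some prime `ℓ` (`exists_level_glOne`, infinitely many places).

So any proof of the crux must USE `v ∤ ℓ`: the statement is tight in its place clause, and the
natural strengthening "compatible at every unramified place" is refuted.  (Mathematically: `r_{ℓ,ι}(π)`
is de Rham but typically RAMIFIED at `v ∣ ℓ`; the witness is the cyclotomic character.)

All ingredients are PROVED tree theorems: the `GL₁` dictionary (`exists_automorphicRepData_detTwist_glOne`,
`hasSatakeParamAt_detTwist_glOne`, `exists_eq_singleton_of_hasSatakeParamAt_glOne`,
`exists_hasInfinityType_of_hasInfinityType_heckeCharacter_glOne`), the norm character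
(`isAlgebraic_normCharacter`, `isUnramifiedAt_normCharacter`, `valueAtUniformizer_normCharacter`),
Frobenius elements (`primesAbove_nonempty`, `exists_isArithFrobAt_of_mem_primesAbove_holds`),
`ι` exists (`PadicAlgCl.nonempty_ringEquiv_complex`), compactness of `Γ_K`.

Refs: J.-P. Serre, *Abelian ℓ-adic representations* (1968), Ch. I §1.2 (the cyclotomic character is
unramified exactly away from `ℓ`), Ch. I §1.1 (ℓ-adic representations of compact groups stabilise a
lattice); A. Weil (1956) §1 (`‖·‖` is of type `A₀`).
-/

noncomputable section

set_option linter.dupNamespace false -- project-wide option (lakefile weak.linter.dupNamespace); `Summit.Langlands.Langlands` is the mandated namespace (D-0017)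

open scoped MatrixGroups Matrix NumberField Polynomial Classical
open NumberField IsDedekindDomain Field Polynomial Filter
open Literature.NumberTheory.Automorphic Literature.NumberTheory.GaloisRepresentations

namespace Summit.Langlands.Langlands.Theorems.GaloisRepOfRegularAlgebraic.Negative

/-! ### The crux with the guard `ℓ ∉ v` dropped

`GaloisRepOfRegularAlgebraicWithoutPrimeToEll` (the name used in the crux work-file
`Cruxes/GaloisRepOfRegularAlgebraic/Disproof.lean`) is the text of the crux
(= `exists_galoisRep_of_regularAlgebraic`, lang.S27) with the hypothesis
`((ℓ : ℕ) : 𝓞 K) ∉ v.asIdeal →` deleted from the place clause, i.e. unramified compatibility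
demanded at EVERY finite place where `π` has a Satake parameter, including those above `ℓ`.  To
keep this file definition-free it is written out inline in the type of
`galoisRepOfRegularAlgebraic_false_without_primeToEll` below. -/

/-! ### Galois side: entries of a rank-one `ℓ`-adic character are `ℓ`-adic units -/

/-- **A continuous `r : Γ_K → GL₁(ℚ̄_ℓ)` takes `ℓ`-adic unit values**: `‖(r σ)₀₀‖ = 1` for every `σ`.
The map `σ ↦ ‖(r σ)₀₀‖` is a continuous homomorphism from the compact group `Γ_K` to the
multiplicative group of positive reals; its image is bounded, and a bounded subgroup of `ℝ_{>0}` is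
trivial (`MonoidHom.eq_one_of_pos_of_bddAbove`).  (Serre 1968, Ch. I §1.1: a compact subgroup of
`GL_n` over an `ℓ`-adic field has unit eigenvalues.) [cite: SerreAbelianLadic1968, Ch. I §1.1] -/
theorem norm_apply_eq_one_of_rank_one {K : Type} [Field K] [CharZero K] {ℓ : ℕ} [Fact ℓ.Prime]
    (r : FramedGaloisRep K (PadicAlgCl ℓ) 1) (σ : absoluteGaloisGroup K) :
    ‖((r σ : GL (Fin 1) (PadicAlgCl ℓ)) : Matrix (Fin 1) (Fin 1) (PadicAlgCl ℓ)) 0 0‖ = 1 := by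
  set e : absoluteGaloisGroup K → PadicAlgCl ℓ := fun τ =>
    ((r τ : GL (Fin 1) (PadicAlgCl ℓ)) : Matrix (Fin 1) (Fin 1) (PadicAlgCl ℓ)) 0 0 with he
  have hmul : ∀ τ τ' : absoluteGaloisGroup K, e (τ * τ') = e τ * e τ' := fun τ τ' => by
    simp only [he, map_mul, Units.val_mul, Matrix.mul_apply, Fin.sum_univ_one]
  have hone : e 1 = 1 := by simp [he]
  have hdet : ∀ τ : absoluteGaloisGroup K,
      e τ = ((Matrix.GeneralLinearGroup.det (r τ) : (PadicAlgCl ℓ)ˣ) : PadicAlgCl ℓ) := fun τ => by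
    rw [Matrix.GeneralLinearGroup.val_det_apply, Matrix.det_fin_one]
  have hne : ∀ τ : absoluteGaloisGroup K, e τ ≠ 0 := fun τ => by
    rw [hdet]
    exact Units.ne_zero _
  have hcont : Continuous e :=
    (Units.continuous_val.comp (map_continuous r)).matrix_elem 0 0
  let f : absoluteGaloisGroup K →* ℝ :=
    { toFun := fun τ => ‖e τ‖
      map_one' := by rw [hone, norm_one]
      map_mul' := fun τ τ' => by rw [hmul, norm_mul] }
  have hpos : ∀ τ, 0 < f τ := fun τ => norm_pos_iff.mpr (hne τ)
  obtain ⟨B, hB⟩ := (isCompact_range hcont.norm).bddAbove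
  have hB' : ∀ τ, f τ ≤ B := fun τ => hB ⟨τ, rfl⟩
  exact MonoidHom.eq_one_of_pos_of_bddAbove f hpos hB' σ

/-- **Rank-one Frobenius values are `ℓ`-adic units.**  If `r : Γ_K → GL₁(ℚ̄_ℓ)` has arithmetic-Frobenius
characteristic polynomial `X - a` at a finite place `v` of the number field `K`, then `‖a‖ = 1`:
a Frobenius `Φ` at a prime `𝔓 ∣ v` exists (`primesAbove_nonempty`,
`exists_isArithFrobAt_of_mem_primesAbove_holds`) and `(r Φ)₀₀ = a` (`hasFrobCharpolyAt_iff_of_rank_one`).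
[folklore] -/
theorem norm_eq_one_of_hasFrobCharpolyAt {K : Type} [Field K] [NumberField K] {ℓ : ℕ} [Fact ℓ.Prime]
    (r : FramedGaloisRep K (PadicAlgCl ℓ) 1) (v : HeightOneSpectrum (𝓞 K)) {a : PadicAlgCl ℓ}
    (h : r.HasFrobCharpolyAt v (X - C a)) : ‖a‖ = 1 := by
  obtain ⟨𝔓, h𝔓⟩ := HeightOneSpectrum.primesAbove_nonempty v
  obtain ⟨Φ, hΦ⟩ := HeightOneSpectrum.exists_isArithFrobAt_of_mem_primesAbove_holds (v := v) h𝔓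
  rw [← (r.hasFrobCharpolyAt_iff_of_rank_one v a).mp h 𝔓 h𝔓 Φ hΦ]
  exact norm_apply_eq_one_of_rank_one r Φ

/-- **Residue cardinalities above `ℓ` are not `ℓ`-adic units**: if `ℓ ∈ v` then `‖(N v : ℚ̄_ℓ)‖ < 1`
(`ℓ ∣ N v`, since `N v ∈ v` — `Ideal.absNorm_mem` — and `ℓ`, `N v` coprime would put `1 ∈ v`).
[folklore] -/
theorem norm_residueCard_lt_one {K : Type} [Field K] [NumberField K] {ℓ : ℕ} [Fact ℓ.Prime]
    {v : HeightOneSpectrum (𝓞 K)} (hv : ((ℓ : ℕ) : 𝓞 K) ∈ v.asIdeal) :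
    ‖((v.residueCard : ℕ) : PadicAlgCl ℓ)‖ < 1 := by
  have hℓ : ℓ.Prime := Fact.out
  have hdvd : ℓ ∣ v.residueCard := by
    by_contra hnd
    have hcop : Nat.Coprime ℓ v.residueCard := (Nat.Prime.coprime_iff_not_dvd hℓ).mpr hnd
    have hq : ((v.residueCard : ℕ) : 𝓞 K) ∈ v.asIdeal := Ideal.absNorm_mem v.asIdeal
    obtain ⟨a, b, hab⟩ := Nat.isCoprime_iff_coprime.mpr hcop
    have h1 : (1 : 𝓞 K) ∈ v.asIdeal := by
      have := congrArg (Int.castRingHom (𝓞 K)) hab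
      simp only [map_add, map_mul, map_one, eq_intCast, Int.cast_natCast] at this
      rw [← this]
      exact v.asIdeal.add_mem (v.asIdeal.mul_mem_left _ hv) (v.asIdeal.mul_mem_left _ hq)
    exact v.isPrime.ne_top ((Ideal.eq_top_iff_one _).mpr h1)
  obtain ⟨m, hm⟩ := hdvd
  rw [hm, Nat.cast_mul, norm_mul]
  have hlt : ‖(ℓ : PadicAlgCl ℓ)‖ < 1 := PadicAlgCl.norm_natCast_p_lt_one ℓ
  have hle : ‖(m : PadicAlgCl ℓ)‖ ≤ 1 := IsUltrametricDist.norm_natCast_le_one _ m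
  calc ‖(ℓ : PadicAlgCl ℓ)‖ * ‖(m : PadicAlgCl ℓ)‖ ≤ ‖(ℓ : PadicAlgCl ℓ)‖ * 1 :=
        mul_le_mul_of_nonneg_left hle (norm_nonneg _)
    _ < 1 := by rw [mul_one]; exact hlt

/-! ### Automorphic side: the `GL₁` datum of the norm character `‖·‖` -/

section NormDatum

variable (K : Type) [Field K] [NumberField K]

/-- **The cuspidal datum `π_{‖·‖} = ℂ·‖det‖ / ⊥` on `GL₁(𝔸_K)`** exists
(`exists_automorphicRepData_detTwist_glOne`; on `GL₁` the cusp condition is empty).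
[cite: BorelJacquet1979, 4.6] -/
theorem exists_normDatum (hcpt : isCompact_glFiniteIntegralLevel 1 K) :
    ∃ π : CuspidalAutomorphicRepData 1 K hcpt,
      π.1.W = Submodule.span ℂ {fun g : (AdelicGroupData.gl 1 K).Adelic =>
        (detTwist 1 (HeckeCharacter.normCharacter K) g : ℂ)} ∧ π.1.W' = ⊥ := by
  obtain ⟨τ, hW, hW'⟩ :=
    exists_automorphicRepData_detTwist_glOne hcpt (HeckeCharacter.normCharacter K)
  have hcusp : τ.W ≤ cuspFormsGL 1 K hcpt := by
    rw [hW, Submodule.span_le]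
    rintro _ rfl
    exact IsCuspFormGL.mem_cuspFormsGL
      ⟨isAutomorphicForm_detTwist_glOne hcpt _, fun k hk hk1 => absurd hk1 (by omega)⟩
  exact ⟨⟨τ, hcusp⟩, hW, hW'⟩

variable {K}
variable {hcpt : isCompact_glFiniteIntegralLevel 1 K}

/-- On the line `ℂ·(θ∘det)`, `GL₁(𝔸_K)` acts through the Hecke character `θ`:
`r(g) φ - θ(det g) φ = 0 ∈ W'` (`rightTranslation_detTwist_glOne`). [folklore] -/
theorem heckeCharacter_of_span (π : AutomorphicRepData (AutomorphyDatum.gl 1 K hcpt))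
    (θ : HeckeCharacter K)
    (hW : π.W = Submodule.span ℂ {fun g : (AdelicGroupData.gl 1 K).Adelic => (detTwist 1 θ g : ℂ)}) :
    ∀ (g : (AdelicGroupData.gl 1 K).Adelic), ∀ φ ∈ π.W,
      rightTranslation (AdelicGroupData.gl 1 K) g φ -
        ((θ (Matrix.GeneralLinearGroup.det g) : ℂˣ) : ℂ) • φ ∈ π.W' := by
  intro g φ hφ
  rw [hW] at hφ
  obtain ⟨c, rfl⟩ := Submodule.mem_span_singleton.mp hφ
  rw [map_smul, rightTranslation_detTwist_glOne, detTwist_apply, smul_comm c, sub_self]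
  exact Submodule.zero_mem _

/-- **`π_{‖·‖}` is regular algebraic.**  `‖·‖` is algebraic (`isAlgebraic_normCharacter`, infinity
type `(p, q)` integral), so `π_{‖·‖}` has an infinity type `T` with `a`-multiset `{-n_ι}` at each
embedding (`exists_hasInfinityType_of_hasInfinityType_heckeCharacter_glOne`); for `n = 1`,
`(n-1)/2 = 0`, so integrality of `a` (and of `b = a - m`) is C-algebraicity, and a singleton is
regular.  (Clozel 1990, §3.3, `n = 1`.) [cite: Clozel1990, §3.3] -/
theorem isRegularAlgebraic_normDatum (π : AutomorphicRepData (AutomorphyDatum.gl 1 K hcpt))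
    (hW : π.W = Submodule.span ℂ {fun g : (AdelicGroupData.gl 1 K).Adelic =>
      (detTwist 1 (HeckeCharacter.normCharacter K) g : ℂ)}) :
    π.IsRegularAlgebraic := by
  have hχ := heckeCharacter_of_span π _ hW
  obtain ⟨p, q, hpq⟩ := (HeckeCharacter.isAlgebraic_iff_exists_hasInfinityType _).mp
    (HeckeCharacter.isAlgebraic_normCharacter (K := K))
  obtain ⟨T, hT, hTa⟩ := π.exists_hasInfinityType_of_hasInfinityType_heckeCharacter_glOne hχ hpq
  refine ⟨T, hT, ?_, ?_⟩
  · intro σ w hw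
    have ha : w.a = -((HeckeCharacter.embExponent p q σ : ℤ) : ℂ) := by
      have hmem : w.a ∈ (T σ).map ArchWeight.a := Multiset.mem_map_of_mem _ hw
      rw [hTa σ, Multiset.mem_singleton] at hmem
      exact hmem
    obtain ⟨m, hm⟩ := w.exists_int_sub
    have hb : w.b = w.a - m := by rw [← hm]; ring
    refine ⟨-HeckeCharacter.embExponent p q σ, -HeckeCharacter.embExponent p q σ - m, ?_, ?_⟩
    · rw [ha]; push_cast; ring
    · rw [hb, ha]; push_cast; ring
  · intro σ
    rw [hTa σ]
    exact Multiset.nodup_singleton _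

/-- **Satake parameters of `π_{‖·‖}`**: any Satake parameter at `v` is `{(N v)⁻¹}` — it is
`{‖ϖ_v‖}` for a uniformizer `ϖ_v` (`exists_eq_singleton_of_hasSatakeParamAt_glOne`), `‖·‖` is
unramified at `v`, and `‖ϖ_v‖ = (N v)⁻¹` (`valueAtUniformizer_normCharacter`).  Tate (1950) §4.3.
[cite: TateThesis1967, §4.3] -/
theorem satakeParam_eq_of_normDatum (π : AutomorphicRepData (AutomorphyDatum.gl 1 K hcpt))
    (hW : π.W = Submodule.span ℂ {fun g : (AdelicGroupData.gl 1 K).Adelic =>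
      (detTwist 1 (HeckeCharacter.normCharacter K) g : ℂ)})
    {v : HeightOneSpectrum (𝓞 K)} {α : Multiset ℂ} (hα : π.HasSatakeParamAt v α) :
    α = {((v.residueCard : ℂ))⁻¹} := by
  have hχ := heckeCharacter_of_span π _ hW
  obtain ⟨ϖ, hϖ, rfl⟩ := π.exists_eq_singleton_of_hasSatakeParamAt_glOne hχ hα
  have hur : (HeckeCharacter.normCharacter K).IsUnramifiedAt v :=
    HeckeCharacter.isUnramifiedAt_normCharacter v
  rw [← HeckeCharacter.localComponent_apply,
    HeckeCharacter.localComponent_eq_valueAtUniformizer hur hϖ,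
    HeckeCharacter.valueAtUniformizer_normCharacter]

/-- **`π_{‖·‖}` has a Satake parameter at some finite place** (indeed off any level `𝔪` of `‖·‖`,
`hasSatakeParamAt_detTwist_glOne`; a number field has infinitely many places and `𝔪 ≠ 0` finitely
many prime factors). [folklore] -/
theorem exists_hasSatakeParamAt_normDatum (π : AutomorphicRepData (AutomorphyDatum.gl 1 K hcpt))
    (hW : π.W = Submodule.span ℂ {fun g : (AdelicGroupData.gl 1 K).Adelic =>
      (detTwist 1 (HeckeCharacter.normCharacter K) g : ℂ)}) (hW' : π.W' = ⊥) :
    ∃ (v : HeightOneSpectrum (𝓞 K)) (α : Multiset ℂ), π.HasSatakeParamAt v α := by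
  obtain ⟨𝔪, h𝔪, hθ𝔪⟩ := HeckeCharacter.exists_level_glOne (HeckeCharacter.normCharacter K)
  haveI := SorensenPatching.infinite_heightOneSpectrum K
  obtain ⟨v, hv⟩ : ∃ v : HeightOneSpectrum (𝓞 K), ¬ v.asIdeal ∣ 𝔪 := by
    by_contra! h
    exact Set.infinite_univ ((Ideal.finite_factors h𝔪).subset fun v _ => h v)
  exact ⟨v, _, AutomorphicRepData.hasSatakeParamAt_detTwist_glOne hcpt hW hW' h𝔪 hθ𝔪 v hv
    (HeckeCharacter.valued_uniformizer (K := K) v)⟩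

/-- **No rank-one `ℓ`-adic character has the predicted Frobenius polynomial of `π_{‖·‖}` at a place
above `ℓ`** — for EVERY number field `K`, prime `ℓ`, field isomorphism `ι : ℚ̄_ℓ ≃+* ℂ`, place `v ∋ ℓ`
and Satake parameter `α` of `π_{‖·‖}` at `v`: the predicted polynomial is `X - N v`
(`satakeParam_eq_of_normDatum`, `arithFrobPolyOfSatake_one`), a Frobenius value `N v` would be an
`ℓ`-adic unit (`norm_eq_one_of_hasFrobCharpolyAt`), but `‖N v‖_ℓ < 1` (`norm_residueCard_lt_one`).
[folklore] -/
theorem not_hasFrobCharpolyAt_normDatum_above (π : AutomorphicRepData (AutomorphyDatum.gl 1 K hcpt))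
    (hW : π.W = Submodule.span ℂ {fun g : (AdelicGroupData.gl 1 K).Adelic =>
      (detTwist 1 (HeckeCharacter.normCharacter K) g : ℂ)})
    {ℓ : ℕ} [Fact ℓ.Prime] (ι : PadicAlgCl ℓ ≃+* ℂ) {v : HeightOneSpectrum (𝓞 K)}
    (hv : ((ℓ : ℕ) : 𝓞 K) ∈ v.asIdeal) {α : Multiset ℂ} (hα : π.HasSatakeParamAt v α)
    (r : FramedGaloisRep K (PadicAlgCl ℓ) 1) :
    ¬ r.HasFrobCharpolyAt v (arithFrobPolyOfSatake ι v.residueCard 1 α) := by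
  intro hfrob
  rw [satakeParam_eq_of_normDatum π hW hα, arithFrobPolyOfSatake_one, Multiset.map_singleton,
    Multiset.prod_singleton, inv_inv, map_natCast] at hfrob
  have h1 := norm_eq_one_of_hasFrobCharpolyAt r v hfrob
  exact (norm_residueCard_lt_one (K := K) hv).ne h1

end NormDatum

/-! ### The negative lemma -/

/-- **Any proof of `GaloisRepOfRegularAlgebraic` must use the guard `v ∤ ℓ`**: the crux with
`((ℓ : ℕ) : 𝓞 K) ∉ v.asIdeal →` deleted is FALSE.  Witness: `n = 1`, `K = ℚ` (totally real),
`π = π_{‖·‖}` (cuspidal, regular algebraic: `isRegularAlgebraic_normDatum`), `v` any place carrying a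
Satake parameter of `π` (`exists_hasSatakeParamAt_normDatum`), `ℓ` the prime below `v`
(`exists_natPrime_natCast_mem`), `ι` any (`PadicAlgCl.nonempty_ringEquiv_complex`): the `r` provided
would have Frobenius polynomial `X - N v` at `v ∣ ℓ`, excluded by
`not_hasFrobCharpolyAt_normDatum_above`.  (The genuine `r_{ℓ,ι}(π_{‖·‖})` is the cyclotomic character,
ramified at `ℓ`: Serre 1968, Ch. I §1.2.) [cite: SerreAbelianLadic1968, Ch. I §1.2] -/
theorem galoisRepOfRegularAlgebraic_false_without_primeToEll :
    ¬ ∀ (n : ℕ) (K : Type) [Field K] [NumberField K] (hcpt : isCompact_glFiniteIntegralLevel n K),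
      (IsTotallyReal K ∨ IsCMField K) → ∀ (π : CuspidalAutomorphicRepData n K hcpt),
      π.1.IsRegularAlgebraic → ∀ (ℓ : ℕ) [Fact ℓ.Prime] (ι : PadicAlgCl ℓ ≃+* ℂ),
      ∃ r : FramedGaloisRep K (PadicAlgCl ℓ) n, r.toGaloisRep.IsSemisimple ∧
        ∀ (v : HeightOneSpectrum (𝓞 K)) (α : Multiset ℂ), π.1.HasSatakeParamAt v α →
          r.IsUnramifiedAt v ∧
            r.HasFrobCharpolyAt v (arithFrobPolyOfSatake ι v.residueCard n α) := by
  intro H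
  have hcpt : isCompact_glFiniteIntegralLevel 1 ℚ := isCompact_glFiniteIntegralLevel_holds 1 ℚ
  obtain ⟨π, hW, hW'⟩ := exists_normDatum ℚ hcpt
  obtain ⟨v, α, hα⟩ := exists_hasSatakeParamAt_normDatum π.1 hW hW'
  obtain ⟨ℓ, hℓ, hℓv⟩ := exists_natPrime_natCast_mem v
  haveI : Fact ℓ.Prime := ⟨hℓ⟩
  obtain ⟨ι⟩ := PadicAlgCl.nonempty_ringEquiv_complex ℓ
  have hRA : π.1.IsRegularAlgebraic := isRegularAlgebraic_normDatum π.1 hW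
  obtain ⟨r, -, hr⟩ := H 1 ℚ hcpt (Or.inl inferInstance) π hRA ℓ ι
  exact not_hasFrobCharpolyAt_normDatum_above π.1 hW ι hℓv hα r (hr v α hα).2

end Summit.Langlands.Langlands.Theorems.GaloisRepOfRegularAlgebraic.Negative

end
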